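import Literature.FieldTheory.FiniteFields.IrreducibleOverExtension
import Literature.FieldTheory.FiniteFields.ConjugatesAndAutomorphisms
import HarnessLib

/-!
# Kramer 1981 §2 Prop. 3 — `dim E(k)[2]` is even iff `Δ` is a square (finite field, odd
# characteristic)

Third proof file towards the discharge of
`Literature.NumberTheory.EllipticCurves.Kramer1981.prop3_ramifiedOddGoodNormIndex` (K. Kramer,
Trans. AMS 264 (1981), §2 Prop. 3, p. 125). Kramer: "It is clear for example by [9, p. 305] that
`dim E(k)₂` is even if and only if, upon reduction, `Δ` becomes a square in `k`" ([9] = Kramer's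
reference for the `2`-division field). This file proves that sentence for an elliptic curve `V`
over a FINITE field `k` of odd characteristic:

* `natCard_torsionBy_two_eq` — `#V(k)[2] = 1 + #{roots in k of the 2-division cubic}`
  (`4X³ + b₂X² + 2b₄X + b₆`, Mathlib `WeierstrassCurve.twoTorsionPolynomial`; a point `(x, y)` has
  order `2` iff `2y + a₁x + a₃ = 0`, Silverman *AEC* III.2.3(d));
* `roots_card_cubic_finiteField` — a separable cubic over a finite field has `0`, `1` or `3` roots,
  and **its discriminant is a square iff the number of roots is not `1`** (`3` roots: the
  discriminant is the square of the difference product; `1` root `r`: `disc = q(r)² · disc(q)` for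
  the complementary irreducible quadratic `q`, whose discriminant is a non-square; `0` roots: the
  roots
  are the Frobenius conjugates `α, α^q, α^{q²}` (Lidl–Niederreiter Thm. 2.14, tree
  `ConjugatesAndAutomorphisms`) and the difference product is Frobenius-invariant, hence rational);
* `exists_natCard_torsionBy_two_eq_two_pow` — **`#V(k)[2] = 2ⁱ` with `i` even iff `Δ ∈ k²`**
  (`disc = 16 Δ`, Mathlib `twoTorsionPolynomial_discr`).

Theorems only; no definition, no named fact.

## References

* [Kramer1981] K. Kramer, Trans. AMS 264 (1981), §2 proof of Prop. 3 (p. 125).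
* [SilvermanAEC2009] J. H. Silverman, *The Arithmetic of Elliptic Curves*, 2nd ed., III.2.3(d),
  III.1 (b₂, b₄, b₆ and `(2y + a₁x + a₃)² = 4x³ + b₂x² + 2b₄x + b₆`).
* [LidlNiederreiter1996] R. Lidl, H. Niederreiter, *Finite Fields*, Thm. 2.14 (conjugates).
-/

noncomputable section

open scoped Classical
open Polynomial
open Literature.FieldTheory.FiniteFields

namespace Literature.NumberTheory.EllipticCurves.Kramer1981

/-! ## §1 Cubics over a field: root counts versus the discriminant -/

section Cubic

variable {K : Type*} [Field K]

/-- A cubic with non-zero discriminant is separable (its roots in `K̄` are distinct). [folklore] -/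
private theorem separable_of_discr_ne_zero {P : Cubic K} (ha : P.a ≠ 0) (hd : P.discr ≠ 0) :
    P.toPoly.Separable := by
  have h0 : P.toPoly ≠ 0 := Cubic.ne_zero_of_a_ne_zero ha
  have hspl : (P.toPoly.map (algebraMap K (AlgebraicClosure K))).Splits := IsAlgClosed.splits _
  have hnd : (Cubic.map (algebraMap K (AlgebraicClosure K)) P).roots.Nodup :=
    (Cubic.discr_ne_zero_iff_roots_nodup ha hspl).mp hd
  rw [Cubic.map_roots] at hnd
  exact (separable_map (algebraMap K (AlgebraicClosure K))).mp
    ((nodup_roots_iff_of_splits (Polynomial.map_ne_zero h0) hspl).mp hnd)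

/-- A cubic has at most `3` roots. [folklore] -/
private theorem roots_card_le_three {P : Cubic K} (ha : P.a ≠ 0) :
    Multiset.card P.toPoly.roots ≤ 3 :=
  (card_roots' _).trans (Cubic.natDegree_of_a_ne_zero ha).le

/-- A cubic never has exactly `2` roots counted with multiplicity... in the sense of Mathlib's root
multiset: if it has `2` of its `3` roots in `K`, the third is in `K` as well. [folklore] -/
private theorem roots_card_ne_two {P : Cubic K} (ha : P.a ≠ 0) :
    Multiset.card P.toPoly.roots ≠ 2 := by
  intro h2
  obtain ⟨q, _, hdeg, hqr⟩ := P.toPoly.exists_prod_multiset_X_sub_C_mul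
  rw [h2, Cubic.natDegree_of_a_ne_zero ha] at hdeg
  have hq1 : q.natDegree = 1 := by omega
  have hq0 : q ≠ 0 := by rintro rfl; simp at hq1
  obtain ⟨x, hx⟩ := exists_root_of_degree_eq_one ((degree_eq_iff_natDegree_eq hq0).mpr hq1)
  have hmem : x ∈ q.roots := (mem_roots hq0).mpr hx
  rw [hqr] at hmem
  exact Multiset.notMem_zero _ hmem

/-- **Three rational roots ⇒ the discriminant is a square** (it is the square of
`a² (x - y)(x - z)(y - z)`, Mathlib `Cubic.discr_eq_prod_three_roots`). [folklore] -/
private theorem isSquare_discr_of_roots_card_eq_three {P : Cubic K} (ha : P.a ≠ 0)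
    (h3 : Multiset.card P.toPoly.roots = 3) : IsSquare P.discr := by
  have hcard : Multiset.card (Cubic.map (RingHom.id K) P).roots = 3 := by
    rw [Cubic.map_roots, Polynomial.map_id]; exact h3
  obtain ⟨x, y, z, hxyz⟩ := Multiset.card_eq_three.mp hcard
  have h := Cubic.discr_eq_prod_three_roots (φ := RingHom.id K) ha hxyz
  rw [RingHom.id_apply] at h
  exact ⟨_, by rw [h, sq]⟩

/-- **Exactly one rational root ⇒ the discriminant is NOT a square** (characteristic `≠ 2`): with
the root `r`, `P = (X - r) · q`, `q = aX² + βX + γ` without roots in `K`, and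
`disc P = q(r)² · disc q`; if `disc P` were a square so would be `disc q`, and `q` would have a root
(Mathlib `exists_quadratic_eq_zero`), which would be a second root of `P`. [folklore] -/
private theorem not_isSquare_discr_of_roots_card_eq_one [NeZero (2 : K)] {P : Cubic K}
    (ha : P.a ≠ 0) (hd : P.discr ≠ 0) (h1 : Multiset.card P.toPoly.roots = 1) :
    ¬ IsSquare P.discr := by
  have h0 : P.toPoly ≠ 0 := Cubic.ne_zero_of_a_ne_zero ha
  obtain ⟨r, hr⟩ := Multiset.card_eq_one.mp h1
  have hroot : P.toPoly.IsRoot r := by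
    have : r ∈ P.toPoly.roots := by rw [hr]; exact Multiset.mem_singleton_self r
    exact ((mem_roots h0).mp this)
  have hd' : P.d = -(P.a * r ^ 3 + P.b * r ^ 2 + P.c * r) := by
    have h := hroot
    rw [IsRoot.def, Cubic.toPoly] at h
    simp only [eval_add, eval_mul, eval_C, eval_pow, eval_X] at h
    linear_combination h
  set β := P.b + P.a * r with hβ
  set γ := P.c + r * β with hγ
  -- the value at `x` of `P` factors through the quadratic
  have heval : ∀ x : K, P.toPoly.eval x = (x - r) * (P.a * (x * x) + β * x + γ) := by
    intro x
    rw [Cubic.toPoly]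
    simp only [eval_add, eval_mul, eval_C, eval_pow, eval_X]
    rw [hd', hγ, hβ]; ring
  have hident : P.discr = (P.a * r ^ 2 + β * r + γ) ^ 2 * discrim P.a β γ := by
    rw [Cubic.discr, discrim, hd', hγ, hβ]; ring
  have hqr : P.a * r ^ 2 + β * r + γ ≠ 0 := by
    intro hz; apply hd; rw [hident, hz]; ring
  rintro ⟨s, hs⟩
  have hQ2 : (P.a * r ^ 2 + β * r + γ) ^ 2 ≠ 0 := pow_ne_zero 2 hqr
  have hdsq : ∃ t, discrim P.a β γ = t * t := by
    refine ⟨s / (P.a * r ^ 2 + β * r + γ), ?_⟩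
    have e : discrim P.a β γ = P.discr / (P.a * r ^ 2 + β * r + γ) ^ 2 := by
      rw [hident, mul_comm, mul_div_assoc, div_self hQ2, mul_one]
    rw [e, hs]
    field_simp
  obtain ⟨x, hx⟩ := exists_quadratic_eq_zero ha hdsq
  have hxroot : x ∈ P.toPoly.roots := by
    rw [mem_roots h0, IsRoot.def, heval, hx, mul_zero]
  rw [hr, Multiset.mem_singleton] at hxroot
  subst hxroot
  apply hqr
  linear_combination hx

/-- **No rational root ⇒ the discriminant is a square** (finite base field): the cubic is
irreducible, its roots in a splitting field are the Frobenius conjugates `α, α^q, α^{q²}` of one of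
them (Lidl–Niederreiter, *Finite Fields*, Thm. 2.14; tree `ConjugatesAndAutomorphisms`), and the
difference product `a²(α - α^q)(α - α^{q²})(α^q - α^{q²})`, whose square is the discriminant, is
fixed by Frobenius (`α^{q³} = α`), hence lies in the base field.
[cite: LidlNiederreiter1996, Theorem 2.14] -/
theorem isSquare_discr_of_roots_card_eq_zero [Finite K] {P : Cubic K} (ha : P.a ≠ 0)
    (h0r : Multiset.card P.toPoly.roots = 0) : IsSquare P.discr := by
  classical
  haveI : Fintype K := Fintype.ofFinite K
  have hp0 : P.toPoly ≠ 0 := Cubic.ne_zero_of_a_ne_zero ha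
  have hdeg : P.toPoly.natDegree = 3 := Cubic.natDegree_of_a_ne_zero ha
  have hroots : P.toPoly.roots = 0 := Multiset.card_eq_zero.mp h0r
  have hirr : Irreducible P.toPoly :=
    (irreducible_iff_roots_eq_zero_of_degree_le_three (by rw [hdeg]; norm_num) hdeg.le).mpr hroots
  -- a splitting field and a root
  let L := P.toPoly.SplittingField
  haveI : Fintype L := Fintype.ofFinite L
  have hspl : (P.toPoly.map (algebraMap K L)).Splits := SplittingField.splits _
  obtain ⟨α, hα⟩ : ∃ α : L, aeval α P.toPoly = 0 := by
    have hdeg' : (P.toPoly.map (algebraMap K L)).degree ≠ 0 := by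
      rw [degree_map, Cubic.degree_of_a_ne_zero ha]; norm_num
    obtain ⟨α, hα⟩ := hspl.exists_eval_eq_zero hdeg'
    exact ⟨α, by rwa [eval_map_algebraMap] at hα⟩
  -- the minimal polynomial of `α` has degree `3`
  have hmin : (minpoly K α).natDegree = 3 := by
    rw [← minpoly.eq_of_irreducible hirr hα, natDegree_mul_leadingCoeff_inv _ hp0, hdeg]
  set q := Fintype.card K with hq
  have hα3 : α ^ q ^ 3 = α := by
    have := ConjugatesAndAutomorphisms.pow_card_pow_natDegree_minpoly K L α
    rwa [hmin] at this
  -- the conjugates are roots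
  have hconj : ∀ j : ℕ, α ^ q ^ j ∈ (P.toPoly.map (algebraMap K L)).roots := fun j => by
    rw [mem_roots (Polynomial.map_ne_zero hp0), IsRoot.def, eval_map_algebraMap]
    exact ConjugatesAndAutomorphisms.aeval_frobConj_eq_zero K L P.toPoly α j hα
  -- and pairwise distinct
  have hinj := ConjugatesAndAutomorphisms.pow_card_pow_injOn K L α
  rw [hmin] at hinj
  have h01 : α ≠ α ^ q := by
    intro h
    have := hinj (show (0 : ℕ) ∈ Set.Iio 3 by simp) (show (1 : ℕ) ∈ Set.Iio 3 by simp)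
      (by simp only [pow_zero, pow_one]; exact h)
    exact zero_ne_one this
  have h02 : α ≠ α ^ q ^ 2 := by
    intro h
    have := hinj (show (0 : ℕ) ∈ Set.Iio 3 by simp) (show (2 : ℕ) ∈ Set.Iio 3 by simp)
      (by simp only [pow_zero, pow_one]; exact h)
    exact absurd this (by norm_num)
  have h12 : α ^ q ≠ α ^ q ^ 2 := by
    intro h
    have := hinj (show (1 : ℕ) ∈ Set.Iio 3 by simp) (show (2 : ℕ) ∈ Set.Iio 3 by simp)
      (by simp only [pow_one]; exact h)
    exact absurd this (by norm_num)
  -- hence the root multiset is `{α, α^q, α^{q²}}`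
  have h3 : (Cubic.map (algebraMap K L) P).roots = {α, α ^ q, α ^ q ^ 2} := by
    rw [Cubic.map_roots]
    symm
    apply Multiset.eq_of_le_of_card_le
    · refine (Multiset.le_iff_subset ?_).mpr ?_
      · simp only [Multiset.insert_eq_cons, Multiset.nodup_cons, Multiset.mem_cons,
          Multiset.mem_singleton, Multiset.nodup_singleton, and_true, not_or]
        exact ⟨⟨h01, h02⟩, h12⟩
      · intro β hβ
        simp only [Multiset.insert_eq_cons, Multiset.mem_cons, Multiset.mem_singleton] at hβ
        rcases hβ with rfl | rfl | rfl
        · have := hconj 0; rwa [pow_zero, pow_one] at this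
        · have := hconj 1; rwa [pow_one] at this
        · exact hconj 2
    · calc Multiset.card (P.toPoly.map (algebraMap K L)).roots
          ≤ (P.toPoly.map (algebraMap K L)).natDegree := card_roots' _
        _ = 3 := by rw [natDegree_map_eq_of_injective (algebraMap K L).injective, hdeg]
        _ = Multiset.card ({α, α ^ q, α ^ q ^ 2} : Multiset L) := by simp
  -- the difference product `δ` with `δ² = disc`
  have hdisc := Cubic.discr_eq_prod_three_roots ha h3
  set δ := algebraMap K L P.a * algebraMap K L P.a * (α - α ^ q) * (α - α ^ q ^ 2) *
    (α ^ q - α ^ q ^ 2) with hδ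
  -- `δ` is fixed by Frobenius
  set f := FiniteField.frobeniusAlgEquivOfAlgebraic K L with hf
  have hfx : ∀ x : L, f x = x ^ q := fun x => by
    rw [hf, FiniteField.coe_frobeniusAlgEquivOfAlgebraic]
  have e2 : q * q = q ^ 2 := (sq q).symm
  have e3 : q * q ^ 2 = q ^ 3 := by ring
  have hfα : f α = α ^ q := hfx α
  have hfαq : f (α ^ q) = α ^ q ^ 2 := by rw [map_pow, hfα, ← pow_mul, e2]
  have hfαq2 : f (α ^ q ^ 2) = α := by rw [map_pow, hfα, ← pow_mul, e3, hα3]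
  have hfδ : f δ = δ := by
    rw [hδ]
    simp only [map_mul, map_sub, AlgEquiv.commutes]
    rw [hfαq2, hfαq, hfα]
    ring
  have hδq : δ ^ q = δ := by rw [← hfx δ]; exact hfδ
  -- hence `δ ∈ K`
  have hδmem : δ ∈ (algebraMap K L).range := by
    rw [← minpoly.natDegree_eq_one_iff, ← Nat.dvd_one,
      ← IrreducibleOverExtension.pow_card_pow_eq_self_iff (K := K) δ 1, pow_one]
    exact hδq
  obtain ⟨c, hc⟩ := hδmem
  refine ⟨c, (algebraMap K L).injective ?_⟩
  rw [hdisc, map_mul, hc, sq]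

/-- **A separable cubic over a finite field of odd characteristic has `0`, `1` or `3` roots, and its
discriminant is a square iff the number of roots is not `1`.** [folklore] -/
private theorem roots_card_cubic_finiteField [Finite K] [NeZero (2 : K)] {P : Cubic K}
    (ha : P.a ≠ 0) (hd : P.discr ≠ 0) :
    (Multiset.card P.toPoly.roots = 0 ∧ IsSquare P.discr) ∨
      (Multiset.card P.toPoly.roots = 1 ∧ ¬ IsSquare P.discr) ∨
      (Multiset.card P.toPoly.roots = 3 ∧ IsSquare P.discr) := by
  have hle := roots_card_le_three ha
  have hne := roots_card_ne_two ha
  interval_cases h : Multiset.card P.toPoly.roots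
  · exact Or.inl ⟨rfl, isSquare_discr_of_roots_card_eq_zero ha h⟩
  · exact Or.inr (Or.inl ⟨rfl, not_isSquare_discr_of_roots_card_eq_one ha hd h⟩)
  · exact absurd rfl hne
  · exact Or.inr (Or.inr ⟨rfl, isSquare_discr_of_roots_card_eq_three ha h⟩)

end Cubic

/-! ## §2 The `2`-torsion of an elliptic curve and the `2`-division cubic -/

section TwoTorsion

variable {k : Type*} [Field k] (V : WeierstrassCurve k) [V.IsElliptic]

omit [V.IsElliptic] in
/-- `(2y + a₁x + a₃)² = 4 (y² + a₁xy + a₃y - x³ - a₂x² - a₄x - a₆) + (4x³ + b₂x² + 2b₄x + b₆)`: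
the `2`-division cubic is the Weierstrass equation completed to a square (Silverman *AEC* III.1).
[cite: SilvermanAEC2009, III.1 (the substitution y ↦ (y - a₁x - a₃)/2)] -/
theorem eval_twoTorsionPolynomial_eq (x y : k) :
    V.twoTorsionPolynomial.toPoly.eval x =
      (2 * y + V.a₁ * x + V.a₃) ^ 2 -
        4 * (y ^ 2 + V.a₁ * x * y + V.a₃ * y - (x ^ 3 + V.a₂ * x ^ 2 + V.a₄ * x + V.a₆)) := by
  rw [WeierstrassCurve.twoTorsionPolynomial, Cubic.toPoly]
  simp only [eval_add, eval_mul, eval_C, eval_pow, eval_X, WeierstrassCurve.b₂,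
    WeierstrassCurve.b₄, WeierstrassCurve.b₆]
  ring

omit [V.IsElliptic] in
/-- An affine point has order dividing `2` iff `y = -y - a₁x - a₃`, i.e. it is its own negative
(Silverman *AEC* III.2.3(d)). [cite: SilvermanAEC2009, III.2.3(d)] -/
theorem two_nsmul_some_eq_zero_iff {x y : k} (h : V.toAffine.Nonsingular x y) :
    (2 : ℕ) • (WeierstrassCurve.Affine.Point.some x y h : V.toAffine.Point) = 0 ↔
      2 * y + V.a₁ * x + V.a₃ = 0 := by
  rw [two_nsmul, add_eq_zero_iff_eq_neg, WeierstrassCurve.Affine.Point.neg_some,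
    WeierstrassCurve.Affine.Point.some.injEq, WeierstrassCurve.Affine.negY]
  constructor
  · rintro ⟨-, hy⟩; linear_combination hy
  · intro hy; exact ⟨rfl, by linear_combination hy⟩

/-- **`#V(k)[2] = 1 + #{x ∈ k : 4x³ + b₂x² + 2b₄x + b₆ = 0}`** for an elliptic curve over a field
of characteristic `≠ 2`: the points of order `2` are the `(x, -(a₁x + a₃)/2)` with `x` a root of the
`2`-division cubic (Silverman *AEC* III.2.3(d) / Ex. 3.7). Here with the root multiset of Mathlib's
`twoTorsionPolynomial`, which has no repeated roots (`disc = 16Δ ≠ 0`).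
[cite: SilvermanAEC2009, III.2.3(d)] -/
theorem natCard_torsionBy_two_eq (h2 : (2 : k) ≠ 0) [Finite V.toAffine.Point] :
    Nat.card (AddSubgroup.torsionBy V.toAffine.Point (2 : ℤ)) =
      Multiset.card V.twoTorsionPolynomial.toPoly.roots + 1 := by
  classical
  set Ψ := V.twoTorsionPolynomial with hΨ
  have ha : Ψ.a ≠ 0 := by
    change (4 : k) ≠ 0
    have : (4 : k) = 2 * 2 := by norm_num
    rw [this]; exact mul_ne_zero h2 h2
  have h0 : Ψ.toPoly ≠ 0 := Cubic.ne_zero_of_a_ne_zero ha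
  -- the ordinate over a root
  set yof : k → k := fun x => -(V.a₁ * x + V.a₃) / 2 with hyof
  have hyrel : ∀ x, 2 * yof x + V.a₁ * x + V.a₃ = 0 := fun x => by
    rw [hyof]; field_simp; ring
  have hns : ∀ x, Ψ.toPoly.IsRoot x → V.toAffine.Nonsingular x (yof x) := by
    intro x hx
    refine WeierstrassCurve.Affine.equation_iff_nonsingular.mp ?_
    rw [WeierstrassCurve.Affine.equation_iff]
    have he := eval_twoTorsionPolynomial_eq V x (yof x)
    rw [← hΨ, hx.eq_zero, hyrel, zero_pow two_ne_zero, zero_sub] at he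
    have h4 : (4 : k) ≠ 0 := by
      have : (4 : k) = 2 * 2 := by norm_num
      rw [this]; exact mul_ne_zero h2 h2
    have := neg_eq_zero.mp he.symm
    rcases mul_eq_zero.mp this with h | h
    · exact absurd h h4
    · linear_combination h
  -- the map from `Option {roots}` to the `2`-torsion
  let T := AddSubgroup.torsionBy V.toAffine.Point (2 : ℤ)
  have hmemT : ∀ P : V.toAffine.Point, P ∈ T ↔ (2 : ℕ) • P = 0 := fun P => by
    change P ∈ AddSubgroup.torsionBy V.toAffine.Point ((2 : ℕ) : ℤ) ↔ _
    exact AddSubgroup.torsionBy.nsmul_iff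
  let g : Option {x // x ∈ Ψ.toPoly.roots.toFinset} → T := fun o =>
    match o with
    | none => ⟨0, T.zero_mem⟩
    | some x => ⟨.some x.1 (yof x.1) (hns x.1 ((mem_roots h0).mp (Multiset.mem_toFinset.mp x.2))),
        (hmemT _).mpr ((two_nsmul_some_eq_zero_iff V _).mpr (hyrel x.1))⟩
  have hg : Function.Bijective g := by
    constructor
    · rintro (_ | ⟨x, hx⟩) (_ | ⟨x', hx'⟩) hxx'
      · rfl
      · exact absurd (congrArg Subtype.val hxx') (by
          change (0 : V.toAffine.Point) ≠ WeierstrassCurve.Affine.Point.some _ _ _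
          exact fun h => WeierstrassCurve.Affine.Point.some_ne_zero _ h.symm)
      · exact absurd (congrArg Subtype.val hxx') (by
          change WeierstrassCurve.Affine.Point.some _ _ _ ≠ (0 : V.toAffine.Point)
          exact fun h => WeierstrassCurve.Affine.Point.some_ne_zero _ h)
      · have h := congrArg Subtype.val hxx'
        change WeierstrassCurve.Affine.Point.some _ _ _ =
          WeierstrassCurve.Affine.Point.some _ _ _ at h
        rw [WeierstrassCurve.Affine.Point.some.injEq] at h
        obtain ⟨hx1, -⟩ := h
        subst hx1
        rfl
    · rintro ⟨P, hP⟩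
      rcases P with _ | ⟨x, y, hxy⟩
      · exact ⟨none, rfl⟩
      · have h2P := (hmemT _).mp hP
        have hy : 2 * y + V.a₁ * x + V.a₃ = 0 := (two_nsmul_some_eq_zero_iff V hxy).mp h2P
        have heq : y ^ 2 + V.a₁ * x * y + V.a₃ * y = x ^ 3 + V.a₂ * x ^ 2 + V.a₄ * x + V.a₆ :=
          (WeierstrassCurve.Affine.equation_iff ..).mp hxy.1
        have hroot : Ψ.toPoly.IsRoot x := by
          rw [IsRoot.def, hΨ, eval_twoTorsionPolynomial_eq V x y, hy, heq]
          ring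
        have hyx : yof x = y := by
          change -(V.a₁ * x + V.a₃) / 2 = y
          rw [div_eq_iff h2]
          linear_combination -hy
        refine ⟨some ⟨x, Multiset.mem_toFinset.mpr ((mem_roots h0).mpr hroot)⟩, ?_⟩
        apply Subtype.ext
        change WeierstrassCurve.Affine.Point.some x (yof x) _ =
          WeierstrassCurve.Affine.Point.some x y hxy
        simp only [hyx]
  rw [← Nat.card_eq_of_bijective g hg, Nat.card_eq_fintype_card, Fintype.card_option,
    Fintype.card_coe, Multiset.toFinset_card_of_nodup]
  exact nodup_roots (separable_of_discr_ne_zero ha (by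
    rw [hΨ, WeierstrassCurve.twoTorsionPolynomial_discr]
    exact mul_ne_zero (by
      have : (16 : k) = 2 ^ 4 := by norm_num
      rw [this]; exact pow_ne_zero 4 h2) V.isUnit_Δ.ne_zero))

/-- **`#V(k)[2] = 2ⁱ` with `i` even iff `Δ` is a square in `k`** (Kramer 1981, p. 125: "`dim E(k)₂`
is even if and only if, upon reduction, `Δ` becomes a square in `k`"), for an elliptic curve over a
finite field of odd characteristic: `#V(k)[2] - 1` is the number of roots of the separable
`2`-division cubic, `0`, `1` or `3`, and its discriminant `16 Δ` is a square iff that number is not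
`1`.
[cite: Kramer1981, §2 proof of Prop. 3 (p. 125), "dim E(k)₂ is even iff Δ becomes a square in k"] -/
theorem exists_natCard_torsionBy_two_eq_two_pow [Finite k] (h2 : (2 : k) ≠ 0) :
    ∃ i : ℕ, Nat.card (AddSubgroup.torsionBy V.toAffine.Point (2 : ℤ)) = 2 ^ i ∧
      (Even i ↔ IsSquare V.Δ) := by
  classical
  haveI : NeZero (2 : k) := ⟨h2⟩
  haveI : Finite V.toAffine.Point := by
    refine Finite.of_injective (fun P : V.toAffine.Point ↦ match P with
      | .zero => (none : Option (k × k))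
      | .some x y _ => some (x, y)) ?_
    rintro (_ | ⟨x, y, h⟩) (_ | ⟨x', y', h'⟩) hPQ
    · rfl
    · simp at hPQ
    · simp at hPQ
    · simp only [Option.some.injEq, Prod.mk.injEq] at hPQ
      obtain ⟨rfl, rfl⟩ := hPQ
      rfl
  have ha : V.twoTorsionPolynomial.a ≠ 0 := by
    change (4 : k) ≠ 0
    have : (4 : k) = 2 * 2 := by norm_num
    rw [this]; exact mul_ne_zero h2 h2
  have h16 : (16 : k) ≠ 0 := by
    have : (16 : k) = 2 ^ 4 := by norm_num
    rw [this]; exact pow_ne_zero 4 h2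
  have hd : V.twoTorsionPolynomial.discr ≠ 0 := by
    rw [WeierstrassCurve.twoTorsionPolynomial_discr]
    exact mul_ne_zero h16 V.isUnit_Δ.ne_zero
  -- `IsSquare (16 Δ) ↔ IsSquare Δ`
  have hsq : IsSquare V.twoTorsionPolynomial.discr ↔ IsSquare V.Δ := by
    rw [WeierstrassCurve.twoTorsionPolynomial_discr]
    have h4 : (4 : k) ≠ 0 := by
      have : (4 : k) = 2 * 2 := by norm_num
      rw [this]; exact mul_ne_zero h2 h2
    constructor
    · rintro ⟨s, hs⟩
      refine ⟨s / 4, ?_⟩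
      rw [div_mul_div_comm, eq_div_iff (mul_ne_zero h4 h4)]
      linear_combination hs
    · rintro ⟨s, hs⟩
      exact ⟨4 * s, by rw [hs]; ring⟩
  rw [natCard_torsionBy_two_eq V h2]
  rcases roots_card_cubic_finiteField ha hd with ⟨h0, hS⟩ | ⟨h1, hS⟩ | ⟨h3, hS⟩
  · exact ⟨0, by rw [h0]; norm_num, by simp [hsq.mp hS]⟩
  · refine ⟨1, by rw [h1]; norm_num, ?_⟩
    simp only [Nat.not_even_one, false_iff]
    exact fun h => hS (hsq.mpr h)
  · exact ⟨2, by rw [h3]; norm_num, by simp [hsq.mp hS]⟩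

end TwoTorsion

end Literature.NumberTheory.EllipticCurves.Kramer1981

end
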